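import Mathlib
import HarnessLib
import Summits.NavierStokesRegularity.NavierStokesRegularity.Theorems.PoloidalWindowDoorPoloidalWindowRigidityFarJet8

/-!
# Non-symmetric steady poloidal 8-jet `U8` — degree-6 Navier–Stokes coefficients, component 1

Cell ns-regularity-ideate, seat ns-poloidal-K2-cert-1 g2, 2026-08-27. Sequel of `…PoloidalWindowRigidityFarJet8` (data `U8, P8`, evaluator
`nsCoeff`, semantics and the degree-`≤ 4` identities there): the remaining steady Navier–Stokes jet equations, split off only for the
gate's per-file elaboration budget. Each theorem: all Taylor coefficients of the given degree of `((U8·∇)U8 + ∇P8 − ΔU8)ᵢ` vanish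
(`decide +kernel`, no `native_decide`). Bears on LADDER-NS N0, crux K2 `PoloidalWindowRigidity` (stmt-NavierStokesRegularity-19708).

WHAT THIS IS NOT: not NS, not K2/LrcModEntire — exact rational bookkeeping for an explicit formal 8-jet.
-/

set_option linter.dupNamespace false
set_option autoImplicit false

namespace Summit.NavierStokesRegularity.NavierStokesRegularity.Theorems.PoloidalWindowDoorPoloidalWindowRigidityFarJet8

/-- steady NS jet equations for `U8, P8`, component `1`, degree `6`: all `28` Taylor coefficients vanish. -/
theorem nsCoeff_eq_zero_1_6 : ((expsEq 6).all fun m => decide (nsCoeff 1 m = 0)) = true := by decide +kernel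

end Summit.NavierStokesRegularity.NavierStokesRegularity.Theorems.PoloidalWindowDoorPoloidalWindowRigidityFarJet8
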